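import Summits.SmoothPoincare4.SmoothPoincare4.Theorems.ConvexBisectionAcyclicBisectionExistsKasMirror
import Summits.SmoothPoincare4.SmoothPoincare4.Theorems.ConvexBisectionAcyclicBisectionExistsKasLoops
import Summits.SmoothPoincare4.SmoothPoincare4.Theorems.ConvexBisectionAcyclicBisectionExistsDualHandleBeltMap
import HarnessLib

/-!
# Mirroring a handle keeps the framed Lefschetz link and REVERSES the belt circle
(evidence for the reshaping of node T3c-1 `node_belt_isotopic_pushoff` of the sub-goal T3 of stub
`stub_steinRealisation` (NF6), line `modp-braid-orbits`, crux `ConvexBisection.AcyclicBisectionExists`,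
item stmt-SmoothPoincare4-10508; wave 2, worker V6, lead c5)

The node T3c-1 asks for a link isotopy in `∂X` from the PARAMETRISED belt circles
`θ ↦ D.jB j (0, 0, θ)` of a Lefschetz multi-attachment `(h, D)` to framed page curves `K j` with
the SAME shadows `(l.get j).1`.  This file shows that the orientation of the belt circle relative to
the attaching circle is not determined by `IsLefschetzLink`: re-framing the handles selected by
`p : ι → Bool` by Kosinski's mirror `diag(1,1,1,−1)` (`mirrorFamily`, …KasMirror.lean: same ranges,
same attaching circles, same handle framings, hence `IsLefschetzLink g l (mirrorFamily h p)` for the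
same word, `isLefschetzLink_mirrorFamily`) and re-framing the multi-attachment DATA accordingly
(`MultiAttachmentData.reframe`: keep `jA`, precompose `jB i` with the mirror — the data-level form
of the tree's `IsMultiAttachment.reframe`) presents the SAME `X` with the SAME base piece `D.jA`,
but the belt circle of a mirrored handle is traversed backwards:
`(beltMap D' j).attachingCircle (e^{2πit}) = (beltMap D j).attachingCircle (e^{-2πit})`
(`attachingCircle_beltMap_mirrorData`).  Since isotopies of parametrised knots preserve the
orientation and reversing a loop negates its shadow (`shadow_eq_neg_of_reverse`, …PageInvariance),
at most one of `(h, D)`, `(h', D')` can satisfy the node with the sign `+`, unless the belt circle is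
invertible up to isotopy in `∂X`; the node is to be read with `shadow (K j) = ± (l.get j).1`
(registered helper `helper_belt_mirror` records the witness).  Everything is proved; no named facts.

## References
* A. A. Kosinski, *Differential Manifolds*, Academic Press (1993), VI §5 (5.1), VI §6. [Kosinski1993]
* R. E. Gompf, A. I. Stipsicz, *4-Manifolds and Kirby Calculus* (1999), §8.2. [GompfStipsicz1999]
-/

noncomputable section

-- the prescribed namespace `Summit.<P>.<Sub>.…` duplicates `SmoothPoincare4` (P = Sub)
set_option linter.dupNamespace false

open scoped Manifold ContDiff Topology
open Set Function Metric

namespace Summit.SmoothPoincare4.SmoothPoincare4.Theorems.AcyclicBisectionExists.ModpBraidOrbits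

open Literature.Topology.FourManifolds Literature.Topology.FourManifolds.HandleAttachingMap
  Literature.Topology.FourManifolds.LefschetzBase

universe u

/-! ### §1 Re-framing multi-attachment DATA by symmetries of the model handle -/

section Reframe

variable {n k : ℕ} {M : Type u} [TopologicalSpace M] [T2Space M]
  [ChartedSpace (EuclideanHalfSpace (n + 1)) M] [IsManifold (𝓡∂ (n + 1)) ∞ M]
  {ι : Type*} [Finite ι] {h : ι → HandleAttachingMap n k M}
  {EP HP : Type*} [NormedAddCommGroup EP] [NormedSpace ℝ EP] [TopologicalSpace HP]
  {IP : ModelWithCorners ℝ EP HP} {P : Type*} [TopologicalSpace P] [ChartedSpace HP P]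

omit [T2Space M] [IsManifold (𝓡∂ (n + 1)) ∞ M] [Finite ι] in
/-- Ranges of maps precomposed with a diffeomorphism. [folklore] -/
theorem range_comp_diffeomorph {X Y Z : Type*} [TopologicalSpace X] [TopologicalSpace Y]
    {EX HX : Type*} [NormedAddCommGroup EX] [NormedSpace ℝ EX] [TopologicalSpace HX]
    {IX : ModelWithCorners ℝ EX HX} [ChartedSpace HX X] [ChartedSpace HX Y]
    (Φ : X ≃ₘ⟮IX, IX⟯ Y) (f : Y → Z) : range (f ∘ Φ) = range f :=
  Φ.surjective.range_comp f

/-- The identification of the (equal) complements of the cores of `h` and of the re-framed family.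
[folklore] -/
def ccReframe (h : ι → HandleAttachingMap n k M) (A : ι → (EuclideanSpace ℝ (Fin (n + 1)) ≃ₗᵢ[ℝ]
      EuclideanSpace ℝ (Fin (n + 1)))) (hA : ∀ i, IsHandleSymmetry k (A i)) :
    ↥(coresComplement fun i => (h i).reframe (A i) (hA i)) ≃ₘ⟮𝓡∂ (n + 1), 𝓡∂ (n + 1)⟯
      ↥(coresComplement h) :=
  opensCongr (Diffeomorph.refl (𝓡∂ (n + 1)) M ∞) _ _ fun _ => mem_coresComplement_reframe_iff h A hA

omit [IsManifold (𝓡∂ (n + 1)) ∞ M] in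
/-- The identification is the identity on points. [folklore] -/
@[simp] theorem coe_ccReframe (A : ι → (EuclideanSpace ℝ (Fin (n + 1)) ≃ₗᵢ[ℝ]
      EuclideanSpace ℝ (Fin (n + 1)))) (hA : ∀ i, IsHandleSymmetry k (A i))
    (a : ↥(coresComplement fun i => (h i).reframe (A i) (hA i))) : (ccReframe h A hA a : M) = a := rfl

/-- **Re-framed multi-attachment data** (the data-level form of `IsMultiAttachment.reframe`,
Kosinski VI §5 (5.1)): keep the embedding `jA` of the base piece (the cores do not change) and
precompose the `i`-th handle with the symmetry `Aᵢ`. [cite: Kosinski1993, VI §5 (5.1)] -/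
def _root_.Literature.Topology.FourManifolds.HandleAttachingMap.MultiAttachmentData.reframe
    (D : MultiAttachmentData h IP P)
    (A : ι → (EuclideanSpace ℝ (Fin (n + 1)) ≃ₗᵢ[ℝ] EuclideanSpace ℝ (Fin (n + 1))))
    (hA : ∀ i, IsHandleSymmetry k (A i)) :
    MultiAttachmentData (fun i => (h i).reframe (A i) (hA i)) IP P where
  disjoint i j hij := by
    change Disjoint (range ((h i).reframe (A i) (hA i)).toFun) (range ((h j).reframe (A j) (hA j)).toFun)
    rw [range_reframe, range_reframe]
    exact D.disjoint hij
  jA := D.jA ∘ ccReframe h A hA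
  jB i := D.jB i ∘ beltCongr (A i) (hA i)
  hjA := D.hjA.comp_openPartialHomeomorph (ccReframe h A hA).toHomeomorph.toOpenPartialHomeomorph rfl
    ((ccReframe h A hA).contMDiff.contMDiffOn.congr fun _ _ => rfl)
    ((ccReframe h A hA).symm.contMDiff.contMDiffOn.congr fun _ _ => rfl)
  hjAo := by rw [range_comp_diffeomorph (ccReframe h A hA) D.jA]; exact D.hjAo
  hjB i := by
    refine ⟨(D.hjB i).1.comp_openPartialHomeomorph
      (beltCongr (A i) (hA i)).toHomeomorph.toOpenPartialHomeomorph rfl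
      ((beltCongr (A i) (hA i)).contMDiff.contMDiffOn.congr fun _ _ => rfl)
      ((beltCongr (A i) (hA i)).symm.contMDiff.contMDiffOn.congr fun _ _ => rfl), ?_⟩
    rw [range_comp_diffeomorph (beltCongr (A i) (hA i)) (D.jB i)]
    exact (D.hjB i).2
  cover := by
    rw [range_comp_diffeomorph (ccReframe h A hA) D.jA]
    have : (⋃ i, range (D.jB i ∘ beltCongr (A i) (hA i))) = ⋃ i, range (D.jB i) :=
      iUnion_congr fun i => range_comp_diffeomorph (beltCongr (A i) (hA i)) (D.jB i)
    rw [this]; exact D.cover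
  glue i a b := by
    change D.jA (ccReframe h A hA a) = D.jB i (beltCongr (A i) (hA i) b) ↔ _
    rw [D.glue i (ccReframe h A hA a), glueRel_reframe_iff]
    rfl
  disjointB i j hij := by
    change Disjoint (range (D.jB i ∘ beltCongr (A i) (hA i))) (range (D.jB j ∘ beltCongr (A j) (hA j)))
    rw [range_comp_diffeomorph (beltCongr (A i) (hA i)) (D.jB i),
      range_comp_diffeomorph (beltCongr (A j) (hA j)) (D.jB j)]
    exact D.disjointB hij

/-- The base piece of the re-framed data is the old one. [folklore] -/
@[simp] theorem jA_reframe (D : MultiAttachmentData h IP P)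
    (A : ι → (EuclideanSpace ℝ (Fin (n + 1)) ≃ₗᵢ[ℝ] EuclideanSpace ℝ (Fin (n + 1))))
    (hA : ∀ i, IsHandleSymmetry k (A i)) (a : ↥(coresComplement fun i => (h i).reframe (A i) (hA i))) :
    (D.reframe A hA).jA a = D.jA (ccReframe h A hA a) := rfl

/-- The handles of the re-framed data are the old ones precomposed with the symmetries. [folklore] -/
@[simp] theorem jB_reframe (D : MultiAttachmentData h IP P)
    (A : ι → (EuclideanSpace ℝ (Fin (n + 1)) ≃ₗᵢ[ℝ] EuclideanSpace ℝ (Fin (n + 1))))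
    (hA : ∀ i, IsHandleSymmetry k (A i)) (i : ι) (b : ↥(beltPiece n k)) :
    (D.reframe A hA).jB i b = D.jB i (beltCongr (A i) (hA i) b) := rfl

end Reframe

/-! ### §2 The mirrored data of a 2-handle multi-attachment and its belt circles -/

section Mirror

variable {M : Type} [TopologicalSpace M] [T2Space M] [ChartedSpace (EuclideanHalfSpace 4) M]
  [IsManifold (𝓡∂ 4) ∞ M] {ι : Type*} [Finite ι] {h : ι → HandleAttachingMap 3 2 M}
  {P : Type*} [TopologicalSpace P] [ChartedSpace (EuclideanHalfSpace 4) P]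

/-- **The mirrored multi-attachment data**: the data of `mirrorFamily h p` on the same `P`
(re-frame the data by the mirrors `diag(1,1,1,−1)` of the selected handles). [cite: Kosinski1993, VI §5 (5.1)] -/
def mirrorData (D : MultiAttachmentData h (𝓡∂ 4) P) (p : ι → Bool) :
    MultiAttachmentData (mirrorFamily h p) (𝓡∂ 4) P :=
  D.reframe (fun i => mirrorIso (p i)) fun i => isHandleSymmetry_mirrorIso (p i)

/-- The mirror of the model handle carries the belt-circle point over `θ` to the one over `θ̄`.
[folklore] -/
theorem beltCongr_mirrorIso_true_beltCirclePt (θ : sphere (0 : EuclideanSpace ℝ (Fin 2)) 1) :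
    beltCongr (mirrorIso true) (isHandleSymmetry_mirrorIso true) (beltCirclePt θ) = beltCirclePt (conjPt θ) := by
  apply Subtype.ext; apply Subtype.ext
  rw [coe_coe_beltCongr, coe_coe_beltCirclePt, coe_coe_beltCirclePt]
  ext i
  rw [mirrorIso_true_apply]
  fin_cases i <;> simp [mirrorSign, conjPt]

/-- Switched off, the mirror fixes the belt-circle points. [folklore] -/
theorem beltCongr_mirrorIso_false_beltCirclePt (θ : sphere (0 : EuclideanSpace ℝ (Fin 2)) 1) :
    beltCongr (mirrorIso false) (isHandleSymmetry_mirrorIso false) (beltCirclePt θ) = beltCirclePt θ := rfl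

/-- **The belt circle of a mirrored handle is the old belt circle composed with conjugation**;
unselected handles keep their belt circles. [cite: Kosinski1993, VI §6] -/
theorem attachingCircle_beltMap_mirrorData (D : MultiAttachmentData h (𝓡∂ 4) P) (p : ι → Bool) (i : ι)
    (θ : sphere (0 : EuclideanSpace ℝ (Fin 2)) 1) :
    (beltMap (mirrorData D p) i).attachingCircle θ =
      (beltMap D i).attachingCircle (if p i then conjPt θ else θ) := by
  rw [attachingCircle_beltMap, attachingCircle_beltMap, mirrorData, jB_reframe]
  -- compare the underlying ball points (the symmetry proof is irrelevant)
  have key : ∀ (b : Bool) (hb : IsHandleSymmetry 2 (mirrorIso b)),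
      beltCongr (mirrorIso b) hb (beltCirclePt θ) = beltCirclePt (if b then conjPt θ else θ) := by
    intro b hb
    cases b
    · exact beltCongr_mirrorIso_false_beltCirclePt θ
    · exact beltCongr_mirrorIso_true_beltCirclePt θ
  rw [key]

/-- **A mirrored handle has its belt circle REVERSED**: `B' (e^{2πit}) = B (e^{−2πit})`.
[cite: Kosinski1993, VI §6] -/
theorem attachingCircle_beltMap_mirrorData_circlePt (D : MultiAttachmentData h (𝓡∂ 4) P) (p : ι → Bool)
    {i : ι} (hi : p i = true) (t : ℝ) :
    (beltMap (mirrorData D p) i).attachingCircle (circlePt t) = (beltMap D i).attachingCircle (circlePt (-t)) := by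
  rw [attachingCircle_beltMap_mirrorData, if_pos hi, conjPt_circlePt]

/-- The base piece of the mirrored data is the old one (same point of `M`). [folklore] -/
theorem jA_mirrorData (D : MultiAttachmentData h (𝓡∂ 4) P) (p : ι → Bool)
    (a : ↥(coresComplement (mirrorFamily h p))) :
    (mirrorData D p).jA a = D.jA ⟨a, (mem_coresComplement_reframe_iff h _ _).1 a.2⟩ := rfl

end Mirror

/-! ### §3 Registered helper -/

/-- **Registered helper `helper_belt_mirror` (evidence for reshaping node T3c-1 of NF6
`stub_steinRealisation`, wave 2, lead c5): mirroring handles keeps the framed Lefschetz link, the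
attached manifold and the base piece, and reverses the selected belt circles.**  For a Lefschetz
link `h` of word `l`, multi-attachment data `D` of `X` and any selection `p` of letters there are a
Lefschetz link `h'` of the SAME word with the same attaching circles, handle framings and cores, and
data `D'` of the SAME `X` with the same base piece `D'.jA = D.jA`, whose belt circles are those of
`D` precomposed with `t ↦ −t` on the selected letters (so their shadows-after-isotopy change sign,
`shadow_eq_neg_of_reverse`): the shadow clause of T3c-1 can only hold up to sign.
[cite: Kosinski1993, VI §5 (5.1)] -/
theorem helper_belt_mirror :
    ∀ (g : ℕ) (l : List ((Fin g ⊕ Fin g → ℤ) × Bool))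
      (h : Fin l.length → Literature.Topology.FourManifolds.HandleAttachingMap 3 2
        (Literature.Topology.FourManifolds.LefschetzBase.Base g))
      (_ : Literature.Topology.FourManifolds.LefschetzBase.IsLefschetzLink g l h)
      {X : Type} [TopologicalSpace X] [ChartedSpace (EuclideanHalfSpace 4) X]
      (D : Literature.Topology.FourManifolds.HandleAttachingMap.MultiAttachmentData h (𝓡∂ 4) X)
      (p : Fin l.length → Bool),
      ∃ (h' : Fin l.length → Literature.Topology.FourManifolds.HandleAttachingMap 3 2
          (Literature.Topology.FourManifolds.LefschetzBase.Base g))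
        (D' : Literature.Topology.FourManifolds.HandleAttachingMap.MultiAttachmentData h' (𝓡∂ 4) X)
        (hc : ∀ a : Literature.Topology.FourManifolds.LefschetzBase.Base g,
          a ∈ Literature.Topology.FourManifolds.HandleAttachingMap.coresComplement h' ↔
            a ∈ Literature.Topology.FourManifolds.HandleAttachingMap.coresComplement h),
        Literature.Topology.FourManifolds.LefschetzBase.IsLefschetzLink g l h' ∧
        (∀ i, (h' i).attachingCircle = (h i).attachingCircle) ∧
        (∀ i, (h' i).attachingFraming = (h i).attachingFraming) ∧
        (∀ i, Set.range (h' i).toFun = Set.range (h i).toFun) ∧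
        (∀ a, D'.jA a = D.jA ⟨a, (hc a).1 a.2⟩) ∧
        (∀ i, p i = false → ∀ θ,
          (Summit.SmoothPoincare4.SmoothPoincare4.Theorems.AcyclicBisectionExists.ModpBraidOrbits.beltMap D' i).attachingCircle θ =
          (Summit.SmoothPoincare4.SmoothPoincare4.Theorems.AcyclicBisectionExists.ModpBraidOrbits.beltMap D i).attachingCircle θ) ∧
        (∀ i, p i = true → ∀ t : ℝ,
          (Summit.SmoothPoincare4.SmoothPoincare4.Theorems.AcyclicBisectionExists.ModpBraidOrbits.beltMap D' i).attachingCircle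
            (Literature.Topology.FourManifolds.circlePt t) =
          (Summit.SmoothPoincare4.SmoothPoincare4.Theorems.AcyclicBisectionExists.ModpBraidOrbits.beltMap D i).attachingCircle
            (Literature.Topology.FourManifolds.circlePt (-t))) := by
  intro g l h hl X _ _ D p
  refine ⟨mirrorFamily h p, mirrorData D p, fun a => mem_coresComplement_reframe_iff h _ _,
    isLefschetzLink_mirrorFamily hl p, fun i => attachingCircle_mirrorMap (h i) (p i),
    fun i => attachingFraming_mirrorMap (h i) (p i), fun i => range_mirrorMap (h i) (p i),
    fun a => rfl, fun i hi θ => ?_, fun i hi t => attachingCircle_beltMap_mirrorData_circlePt D p hi t⟩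
  rw [attachingCircle_beltMap_mirrorData, if_neg (by rw [hi]; exact Bool.false_ne_true)]

end Summit.SmoothPoincare4.SmoothPoincare4.Theorems.AcyclicBisectionExists.ModpBraidOrbits

end
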